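import Summits.QuantumFields.BalabanUV.Beta.GAN24.CombesThomas
import Summits.QuantumFields.BalabanUV.Beta.GAN24.CombesThomasFibre
import Summits.QuantumFields.BalabanUV.Beta.GAN24.DirichletExhaustionDeltaZ
import Literature.MathematicalPhysics.QuantumFieldTheory.Balaban1983to89.Beta.ResolventComposition

/-!
# `BalabanUV.Beta.GAN24.TransverseDictionary` — binder row G-an2-4 / (CONV-C), propagator slot, road P1, leaf P1-L13 (the S6
# dictionary, MULTIPLIER–MULTIPLIER channel): the mm block of the step resolvent `D_j · KInvStep Lc j · D_j` in closed bookkeeping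
# form, its RECIPROCITY (symmetry) by Green pairing, and the mm channel of the wall's binders `hK`/`hKall` REDUCED TO ONE IDENTITY —
# «`s_m(j)² · wΦ^{(Lc^{j+1})} = cΦ · Δ_{j+1}`» ((1.65) = (1.66) for an2's typed system) — which is NOT proved here

NOT IN PRINT; OUR PROOF ATTEMPT.  HONEST FRAMING (cell contract, verbatim): «discharging `BetaPertH` makes Bałaban's UV stability
UNCONDITIONAL — a real constructive-QFT result; it is NOT the continuum limit and NOT the Clay problem.»  HONEST DEPENDENCY (verbatim):
«continuum YM on T⁴ ⇐ BetaPertH ∧ nine spine estimates (0/9 proved); BetaPertH ⇐ (D1) ∧ (D4) ∧ CAP+tail; G-an2-4 gates asym, D1 and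
NE2/3/4.»  ROOT LABEL of the formalisation swarm (ref2 ruling (A), verbatim): «T = O-an2-2a: `convC_balaban_of_coer` ⇐
`Coer2157Z d L (gamma2153 (d+1) L)`; NOT G-an2-4's K-slot `ConvCKWall`; 0 wall binders instantiated».  THIS FILE instantiates 0 wall
binders, asserts NO dictionary (ref2 ruling (C): the S6 identity enters ONLY as an explicit hypothesis `hdict` of §3, never as a `def … : Prop`,
never as a fact), cites nothing, and is [folklore] bookkeeping / Green pairing over the cell's own typed objects.  NOT summit progress.

ABSOLUTE RULE (cell, verbatim): «No internally-minted statement may enter as a cited fact. Every hypothesis is either kernel-proved in this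
package or a verbatim quotation of a PUBLISHED theorem with page reference. The manuscript(s) under audit are NOT citable for their own disputed
steps — they are the thing under adjudication; programme-internal (2001/route/tribunal) claims are never citable.»

## The object and the question (`Fib d = Fin (d+1) ⊕ Fin (d+1)`, multiplier legs = `inr`)

The K-slot of (CONV-C) (`GAN24/CombesThomas.ConvCKWall d Lc`, ≡ the wall's `hK ∧ hKall`) quantifies over ALL leg pairs of
`KStepUnit Lc j = unitK (Lc^j) (Lc^{j(d+1)}) (KInvStep Lc j)`.  Its `(inr κ, inr l)` block — ref2's node N2 «multiplierBlocks» for the mm legs —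
is, by `OneStepKernelFamily.dec` (multiplier legs are READ at coarse points, weight `1`) and `OneStepResolventKernel.KInv` (mm block =
an2's `KernelSpecInstance.wΦ`), the single kernel family `N ↦ wΦ^{(N)}`, `N = Lc^{j+1}`, rescaled by `s_m(j)² = Lc^{2j(d+1)}` (§1,
`KInvStep_inr_inr`, `unitK_KInvStep_inr_inr`).  an5's `ResolventComposition` proved that the gauge multiplier of every minimiser column
vanishes (`wM_eq_zero`) and the gauge-free Euler–Lagrange identity `d*d ℋ = 𝒬ᵀ wΦ` (`curvAdj_curv_Hcol`); §4 pairs it against a second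
minimiser column: `⟨curv ℋ_{(l′,q)}, curv ℋ_{(κ,z)}⟩ = wΦ κ l′ (z − q)` (`lip2_curv_Hcol_Hcol`) — so `wΦ^{(N)}` IS the Gram matrix of the
constrained minimisers, i.e. the quadratic form «min ‖curv A‖² on {𝒬_N A = g}» polarised ((1.65)-type object of the TYPED system), hence
SYMMETRIC (`wΦ_reciprocity`, `KInv_inr_inr_symm`, `unitK_KInvStep_inr_inr_symm`) with nonnegative diagonal (`wΦ_self_nonneg`).
Bałaban's `U = 1` effective action at `n = N` in its PRINTED momentum form (1.66) is p2's `DirichletExhaustionDeltaZ.deltaZ Lc k` on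
`ℤ^{d+1}`, with `k`-uniform decay `deltaZ_abs_le` and η-rate `opClose_deltaZ` (`θ = Lc⁻²`) IN THE TREE (here re-read in the wall's `ℓ¹`
currency, §2; the same family in the (CONV-C)/wall currencies on its own index set: p2 PART 19 `DirichletExhaustionDeltaZConv`, whose
gen-3 S6 analysis (GAPS C-gan24p2-5 (b)(ii): «the mm block IS canonical … the S6 node should be typed for the mm block») this file
implements on the consumer's object).  THE S6-mm DICTIONARY is the identity  `s_m(j)² · wΦ^{(Lc^{j+1})} κ l z = cΦ · deltaZ Lc (j+1) ((z,κ),(0,l))`  (a constant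
`cΦ = cΦ(d, Lc)`; expected finite and `j`-free exactly at `d = 3`, where `s_m² = Lc^{8j}` matches the `N^{−(D+4)}`, `D = 4`, of the block-sum
normalisation — gan24-p1 SKELETON-P1 §7(e) float64 diagnostics, NOT load-bearing).  §3 proves: IF it holds THEN the mm parts of the step
resolvents satisfy the wall's two binder SHAPES with Bałaban's constants — `UniformDecays (j ↦ mmPart (KStepUnit Lc j)) (|cΦ|·c166Z d) (kappaZ d/Lc)`
and `DecayCauchy (…) (|cΦ|·theta166Z d·Lc⁻²/(1−Lc⁻²)) Lc⁻² (kappaZ d/Lc)` (`mm_binders_of_dict`).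

## WHAT IS NOT HERE — the located gap (leaf P1-L13 as cut is the S6-mm NODE, not one leaf)

The identity `hdict` is (1.65) = (1.66) FOR AN2'S TYPED SYSTEM on `ℤ^{d+1}`.  In the tree: (1.65) = (1.66) IS certified ON THE TORUS for
the b05/β-cell typed operators (`B5Hk163Form166.DelK_form_eq_formDk`, `B6Cov2156TorusDelK.deltaPol_eq_DelK`: `deltaPol M n = Δ_k`
entrywise), and `deltaPol` ↔ `deltaZ` by periodisation (p2 `DirichletExhaustionPeriodise`/`…Tails`); what is MISSING is the junction
«an2's `KernelSpecInstance`/`AffineAveraging` system (ℤ^{d+1}, gauge ROWS, unnormalised `𝒬 = blockSum ∘ contourSum`, energy `‖curv A‖²`)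
↔ b05's torus operators (`B5Block118.QvOp`, `B5Hk163Torus.HkOp`, (1.91) gauge `R∂*A = 0`)»: no module imports both worlds
(`Beta/FluctuationProjection` records «the join with an2's Γ_N … NOT here»).  With that junction the proof of `hdict` is ONE Green pairing
(§4's mechanism, between an2's periodised minimiser column and `HkOp`'s column — both are critical points of the SAME gauge-invariant energy on
the SAME constraint hyperplane: `wM_eq_zero` here, `B5Hk163RDiv.R_divS_HkOp` there) plus de-periodisation (`decay_wΦ`, p2's tails engine);
the alternative per-fibre route needs the box-DFT/Bloch dictionary P1-L04a/L04b (not landed).  Re-cut proposed in the cell journal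
(leaf-18, 2026-08-19): S6mm-1 operator bridge, S6mm-2 torus pairing, S6mm-3 de-periodisation, then §3 here becomes unconditional.
ALSO NOT HERE: the field–field / mixed blocks (ref2 N1, the transverse channel of the row text: needs an5's `k1aTrans` currency AND the
same junction), any estimate of `wΦ^{(N)}` uniform in `N` without the dictionary (that is road P1's Part A/B, leaves L08–L11), any
composition law (none is needed: (1.66) at `n = Lc^{j+1}` and an2's one-shot `N`-system are both the COMPOSITE objects), constants `cΦ`.
«not in print; our proof attempt»; NOT the K-slot, NOT `BetaPertH`, NOT continuum, NOT Clay.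

WHAT IS PROVED (0 sorry, axioms standard): §1 **`KInvStep_inr_inr`**, **`unitK_KInvStep_inr_inr`**, `mmPart` (+ `_inr_inr`,
`_inl_left`, `_inl_right`, `_sub`); §2 `deltaZ_abs_le_l1`, `deltaZ_step_abs_le_l1` (p2's PART 8 bounds in `ℓ¹`, t4-ne2-p2's `ratePair_kerFamily2`
BY NAME); §3 `l1_sub_coarse`, `exp_coarse`, `mmPart_KStepUnit_apply`, **`mm_uniformDecays_of_dict`**, **`mm_stepDecays_of_dict`**,
**`mm_decayCauchy_of_dict`**, **`mm_binders_of_dict`** (all CONDITIONAL on `hdict`), `theta_lt_one`; §4 (unconditional) **`lip2_curv_Hcol_Hcol`**,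
**`wΦ_reciprocity`**, `wΦ_symm`, `wΦ_self_nonneg`, **`KInv_inr_inr_symm`**, **`unitK_KInvStep_inr_inr_symm`**.
Unit b2b-balaban-gan24-formalise-leaf-18 (gen 5), leaf P1-L13 of gan24-p1's SKELETON-P1 table, 2026-08-19.
-/

open Finset
open scoped BigOperators
open Literature.Probability.LatticeModels (TorusSite Torus.proj Torus.proj_apply)
open Literature.MathematicalPhysics.QuantumFieldTheory
open Literature.MathematicalPhysics.QuantumFieldTheory.Balaban1983to89
open Literature.MathematicalPhysics.QuantumFieldTheory.Balaban1983to89.Beta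
open LatticeForm (repZ quo)
open B12Sec2to5 (l1 l1_nonneg)
open ExpKernelCalculus (MKer Decays)
open OneStepResolventKernel (Fib KInv KInv_inr_inr_coarse KInv_inr_off quo_zsmul proj_zsmul)
open OneStepKernelFamily (KInvStep dec legSet legPt legW proj_pow_smul_eq_zero_iff)
open KernelSpecInstance (wΦ)
open B4Sect5Exhaustion (K)
open Summit.QuantumFields.BalabanUV.Beta.HessKerDressedUnits (unitK legScale unitK_apply legScale_inr legScale_inl)
open Summit.QuantumFields.BalabanUV.Beta.GAN24.CombesThomas (UniformDecays DecayCauchy SupRate SupBound smStep sfStep KStepUnit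
  decayCauchy_of_stepDecay)
open Summit.QuantumFields.BalabanUV.Beta.GAN24.DirichletExhaustionDeltaZ (deltaZ c166Z theta166Z kappaZ kappaZ_pos deltaZ_abs_le
  deltaZ_step_abs_le)

namespace Summit.QuantumFields.BalabanUV.Beta.GAN24.TransverseDictionary

noncomputable section

variable {d : ℕ} {Lc : ℕ} [NeZero Lc]

/-! ## §1 The multiplier–multiplier block of the step resolvent, in closed bookkeeping form -/

/-- **THE mm BLOCK OF THE DECIMATED COMPOSITE RESOLVENT**: at the `Lc`-coarse points of the step-`j` lattice it is an2's multiplier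
response `wΦ` of blocking `Lc^(j+1)` read at the block-index difference; elsewhere `0`. -/
theorem KInvStep_inr_inr (j : ℕ) (κ l : Fin (d + 1)) (x' y' : Fin (d + 1) → ℤ) :
    KInvStep (d := d) Lc j x' y' (Sum.inr κ) (Sum.inr l) =
      if Torus.proj Lc x' = 0 ∧ Torus.proj Lc y' = 0 then wΦ (N := Lc ^ (j + 1)) κ l (quo Lc x' - quo Lc y') else 0 := by
  simp only [KInvStep, dec, legSet, legW, legPt, Finset.sum_singleton, one_mul]
  by_cases hx : Torus.proj Lc x' = 0
  · by_cases hy : Torus.proj Lc y' = 0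
    · rw [if_pos ⟨hx, hy⟩]
      have ex : ((Lc ^ j : ℕ) : ℤ) • x' = ((Lc ^ (j + 1) : ℕ) : ℤ) • quo Lc x' := by
        conv_lhs => rw [CombesThomasFibre.eq_zsmul_quo_of_proj_eq_zero hx]
        rw [smul_smul]; push_cast; ring_nf
      have ey : ((Lc ^ j : ℕ) : ℤ) • y' = ((Lc ^ (j + 1) : ℕ) : ℤ) • quo Lc y' := by
        conv_lhs => rw [CombesThomasFibre.eq_zsmul_quo_of_proj_eq_zero hy]
        rw [smul_smul]; push_cast; ring_nf
      rw [ex, ey, KInv_inr_inr_coarse]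
    · rw [if_neg (fun h => hy h.2)]
      simp only [KInv]
      rw [if_neg]
      intro h
      exact hy ((proj_pow_smul_eq_zero_iff j y').1 h.2)
  · rw [if_neg (fun h => hx h.1)]
    exact KInv_inr_off (N := Lc ^ (j + 1)) (by rwa [Ne, proj_pow_smul_eq_zero_iff]) κ _ _

/-- The mm block of the UNIT-NORMALISED step resolvent `D_j K_j D_j` (`D_j = diag(s_f j ∣ s_m j)`): the multiplier unit squared times
the mm block. -/
theorem unitK_KInvStep_inr_inr (sf sm : ℕ → ℝ) (j : ℕ) (κ l : Fin (d + 1)) (x' y' : Fin (d + 1) → ℤ) :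
    unitK (sf j) (sm j) (KInvStep (d := d) Lc j) x' y' (Sum.inr κ) (Sum.inr l) =
      sm j ^ 2 * (if Torus.proj Lc x' = 0 ∧ Torus.proj Lc y' = 0 then wΦ (N := Lc ^ (j + 1)) κ l (quo Lc x' - quo Lc y') else 0) := by
  rw [unitK_apply, KInvStep_inr_inr, legScale_inr, legScale_inr]
  ring

/-- **THE mm PART** of a packed kernel: the multiplier–multiplier block kept, all other leg blocks set to `0`. -/
def mmPart (Kk : MKer (d + 1) (Fib d)) : MKer (d + 1) (Fib d) := fun x y a b =>
  match a, b with
  | Sum.inr _, Sum.inr _ => Kk x y a b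
  | _, _ => 0

/-- The mm part on mm legs. -/
@[simp] theorem mmPart_inr_inr (Kk : MKer (d + 1) (Fib d)) (x y : Fin (d + 1) → ℤ) (κ l : Fin (d + 1)) :
    mmPart Kk x y (Sum.inr κ) (Sum.inr l) = Kk x y (Sum.inr κ) (Sum.inr l) := rfl

/-- The mm part vanishes on a field first leg. -/
@[simp] theorem mmPart_inl_left (Kk : MKer (d + 1) (Fib d)) (x y : Fin (d + 1) → ℤ) (κ : Fin (d + 1)) (b : Fib d) :
    mmPart Kk x y (Sum.inl κ) b = 0 := by cases b <;> rfl

/-- The mm part vanishes on a field second leg. -/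
@[simp] theorem mmPart_inl_right (Kk : MKer (d + 1) (Fib d)) (x y : Fin (d + 1) → ℤ) (a : Fib d) (l : Fin (d + 1)) :
    mmPart Kk x y a (Sum.inl l) = 0 := by cases a <;> rfl

/-- The mm part is additive: `mmPart (A − B) = mmPart A − mmPart B`. -/
theorem mmPart_sub (A B : MKer (d + 1) (Fib d)) : mmPart (A - B) = mmPart A - mmPart B := by
  funext x y a b
  cases a with
  | inl κ => simp [HessKerDressedLimit.mker_sub_apply]
  | inr κ =>
    cases b with
    | inl l => simp [HessKerDressedLimit.mker_sub_apply]
    | inr l => simp [HessKerDressedLimit.mker_sub_apply]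

/-! ## §2 Bałaban's `Δ_k` on `ℤ^{d+1}` ((1.66), p2's `deltaZ`): the `ℓ¹` forms of its `k`-uniform decay and one-step rate -/

/-- `|deltaZ L k b b′| ≤ c166Z(d)·e^{−kappaZ(d)·|x−y|₁}` — p2's `deltaZ_abs_le` in the wall's `ℓ¹` currency (t4-ne2-p2's `ratePair_kerFamily2.decay`
BY NAME, without the passage to the sup-distance). -/
theorem deltaZ_abs_le_l1 (L : ℕ) [NeZero L] (k : ℕ) (p q : K (d + 1) (d + 1)) :
    |deltaZ L k p q| ≤ c166Z d * Real.exp (-(kappaZ d) * l1 (p.1 - q.1)) := by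
  have hE : ∀ μ ν, μ ≠ ν → ∀ a b, |T4GaugeActionRatePair.kerFamily (d := d) L μ ν a b k (p.1 - q.1)| ≤
      B5Symbol166Strip.MG (d + 1) * Real.exp (-(kappaZ d) * l1 (p.1 - q.1)) := by
    intro μ ν hμν a b
    exact (T4Rate166StripDirect.ratePair_kerFamily2 (d := d) L hμν a b).decay k (p.1 - q.1)
  have hB : 0 ≤ 4 * (B5Symbol166Strip.MG (d + 1) * Real.exp (-(kappaZ d) * l1 (p.1 - q.1))) := by
    have := B5Symbol166Strip.MG_pos (d + 1); positivity
  unfold deltaZ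
  refine (DirichletExhaustionDeltaZ.abs_sum_sum_le hB fun μ ν hμν =>
    DirichletExhaustionDeltaZ.abs_summand_le (hE μ ν hμν) μ ν p.2 q.2).trans (le_of_eq ?_)
  unfold c166Z; ring

/-- `|deltaZ L (k+1) b b′ − deltaZ L k b b′| ≤ theta166Z(d)·(L⁻²)^k·e^{−kappaZ(d)|x−y|₁}` — p2's `deltaZ_step_abs_le` in the `ℓ¹` currency
(`ratePair_kerFamily2.rate` BY NAME). -/
theorem deltaZ_step_abs_le_l1 (L : ℕ) [NeZero L] (k : ℕ) (p q : K (d + 1) (d + 1)) :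
    |deltaZ L (k + 1) p q - deltaZ L k p q| ≤
      theta166Z d * (((L : ℝ) ^ 2)⁻¹) ^ k * Real.exp (-(kappaZ d) * l1 (p.1 - q.1)) := by
  have hE : ∀ μ ν, μ ≠ ν → ∀ a b, |T4RateAlgebra.step (T4GaugeActionRatePair.kerFamily (d := d) L μ ν a b) k (p.1 - q.1)| ≤
      8 * T4Rate166StripDirect.C166 (d + 1) * (((L : ℝ) ^ 2)⁻¹) ^ k * Real.exp (-(kappaZ d) * l1 (p.1 - q.1)) := by
    intro μ ν hμν a b
    exact (T4Rate166StripDirect.ratePair_kerFamily2 (d := d) L hμν a b).rate k (p.1 - q.1)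
  have hB : 0 ≤ 4 * (8 * T4Rate166StripDirect.C166 (d + 1) * (((L : ℝ) ^ 2)⁻¹) ^ k * Real.exp (-(kappaZ d) * l1 (p.1 - q.1))) := by
    have := T4Rate166StripDirect.C166_pos (d + 1); positivity
  rw [DirichletExhaustionDeltaZ.deltaZ_succ_sub]
  refine (DirichletExhaustionDeltaZ.abs_sum_sum_le hB fun μ ν hμν =>
    DirichletExhaustionDeltaZ.abs_summand_le (hE μ ν hμν) μ ν p.2 q.2).trans (le_of_eq ?_)
  unfold theta166Z; ring

/-! ## §3 The mm channel of the wall's binders `hK` / `hKall`, CONDITIONAL on the S6-mm dictionary identity -/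

section Conditional

variable (d Lc)

/-- On coarse points the `ℓ¹` distance of the step lattice is `Lc` times the `ℓ¹` distance of the block indices. -/
theorem l1_sub_coarse {x' y' : Fin (d + 1) → ℤ} (hx : Torus.proj Lc x' = 0) (hy : Torus.proj Lc y' = 0) :
    l1 (x' - y') = (Lc : ℝ) * l1 (quo Lc x' - quo Lc y') := by
  rw [← ExpKernelCalculus.l1_natSmul, smul_sub, ← CombesThomasFibre.eq_zsmul_quo_of_proj_eq_zero hx,
    ← CombesThomasFibre.eq_zsmul_quo_of_proj_eq_zero hy]

variable {d Lc}

/-- Rescaling the rate: `e^{−κ|u−v|₁} = e^{−(κ/Lc)|x′−y′|₁}` at coarse points `x′ = Lc•u`, `y′ = Lc•v`. -/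
theorem exp_coarse {x' y' : Fin (d + 1) → ℤ} (hx : Torus.proj Lc x' = 0) (hy : Torus.proj Lc y' = 0) (κ₀ : ℝ) :
    Real.exp (-κ₀ * l1 (quo Lc x' - quo Lc y')) = Real.exp (-(κ₀ / Lc) * l1 (x' - y')) := by
  rw [l1_sub_coarse d Lc hx hy]
  have hL : (Lc : ℝ) ≠ 0 := Nat.cast_ne_zero.2 (NeZero.ne Lc)
  congr 1
  field_simp

/-- Under the dictionary identity, the mm entries of `D_j K_j D_j` at coarse points ARE `cΦ · Δ_{j+1}` read at the block indices. -/
theorem mmPart_KStepUnit_apply {cΦ : ℝ}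
    (hdict : ∀ (j : ℕ) (κ l : Fin (d + 1)) (z : Fin (d + 1) → ℤ),
      smStep d Lc j ^ 2 * wΦ (N := Lc ^ (j + 1)) κ l z = cΦ * deltaZ Lc (j + 1) (z, κ) (0, l))
    (j : ℕ) (κ l : Fin (d + 1)) (x' y' : Fin (d + 1) → ℤ) :
    mmPart (KStepUnit (d := d) Lc j) x' y' (Sum.inr κ) (Sum.inr l) =
      if Torus.proj Lc x' = 0 ∧ Torus.proj Lc y' = 0 then cΦ * deltaZ Lc (j + 1) (quo Lc x' - quo Lc y', κ) (0, l) else 0 := by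
  rw [mmPart_inr_inr, KStepUnit, unitK_KInvStep_inr_inr]
  split_ifs with h
  · exact hdict j κ l _
  · rw [mul_zero]

/-- **mm CHANNEL OF `hK`, CONDITIONAL**: under the S6-mm dictionary identity `s_m(j)²·wΦ^{(Lc^{j+1})} = cΦ·Δ_{j+1}` the mm part of the
unit-normalised step resolvents decays `j`-UNIFORMLY, with Bałaban's (1.66) constants: `C = |cΦ|·c166Z(d)`, `δ = kappaZ(d)/Lc`. -/
theorem mm_uniformDecays_of_dict {cΦ : ℝ}
    (hdict : ∀ (j : ℕ) (κ l : Fin (d + 1)) (z : Fin (d + 1) → ℤ),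
      smStep d Lc j ^ 2 * wΦ (N := Lc ^ (j + 1)) κ l z = cΦ * deltaZ Lc (j + 1) (z, κ) (0, l)) :
    UniformDecays (fun j => mmPart (KStepUnit (d := d) Lc j)) (|cΦ| * c166Z d) (kappaZ d / Lc) := by
  intro j x' y' a b
  have hC : 0 ≤ |cΦ| * c166Z d * Real.exp (-(kappaZ d / Lc) * l1 (x' - y')) := by
    have := B5Symbol166Strip.MG_pos (d + 1); unfold c166Z; positivity
  cases a with
  | inl κ => simpa using hC
  | inr κ =>
    cases b with
    | inl l => simpa using hC
    | inr l =>
      change |mmPart (KStepUnit (d := d) Lc j) x' y' (Sum.inr κ) (Sum.inr l)| ≤ _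
      rw [mmPart_KStepUnit_apply hdict]
      split_ifs with h
      · rw [abs_mul, ← exp_coarse h.1 h.2, mul_assoc]
        refine mul_le_mul_of_nonneg_left ?_ (abs_nonneg _)
        have := deltaZ_abs_le_l1 Lc (j + 1) (quo Lc x' - quo Lc y', κ) ((0 : Fin (d + 1) → ℤ), l)
        simpa using this
      · simpa using hC

/-- **ONE-STEP DIFFERENCES OF THE mm CHANNEL, CONDITIONAL**: they decay with the SMALL constant `|cΦ|·theta166Z(d)·Lc⁻²·(Lc⁻²)^j` at rate
`kappaZ(d)/Lc` — Bałaban's η-rate `θ = Lc⁻²` of (1.66) transported by the dictionary. -/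
theorem mm_stepDecays_of_dict {cΦ : ℝ}
    (hdict : ∀ (j : ℕ) (κ l : Fin (d + 1)) (z : Fin (d + 1) → ℤ),
      smStep d Lc j ^ 2 * wΦ (N := Lc ^ (j + 1)) κ l z = cΦ * deltaZ Lc (j + 1) (z, κ) (0, l)) (j : ℕ) :
    Decays (mmPart (KStepUnit (d := d) Lc (j + 1)) - mmPart (KStepUnit (d := d) Lc j))
      (|cΦ| * theta166Z d * (((Lc : ℝ) ^ 2)⁻¹) * (((Lc : ℝ) ^ 2)⁻¹) ^ j) (kappaZ d / Lc) := by
  intro x' y' a b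
  have hC : 0 ≤ |cΦ| * theta166Z d * (((Lc : ℝ) ^ 2)⁻¹) * (((Lc : ℝ) ^ 2)⁻¹) ^ j * Real.exp (-(kappaZ d / Lc) * l1 (x' - y')) := by
    have := T4Rate166StripDirect.C166_pos (d + 1); unfold theta166Z; positivity
  rw [HessKerDressedLimit.mker_sub_apply]
  cases a with
  | inl κ => simpa using hC
  | inr κ =>
    cases b with
    | inl l => simpa using hC
    | inr l =>
      rw [mmPart_KStepUnit_apply hdict, mmPart_KStepUnit_apply hdict]
      split_ifs with h
      · rw [← mul_sub, abs_mul, ← exp_coarse h.1 h.2, mul_assoc, mul_assoc, mul_assoc]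
        refine mul_le_mul_of_nonneg_left ?_ (abs_nonneg _)
        have := deltaZ_step_abs_le_l1 Lc (j + 1) (quo Lc x' - quo Lc y', κ) ((0 : Fin (d + 1) → ℤ), l)
        rw [pow_succ] at this
        simpa [mul_comm, mul_assoc, mul_left_comm] using this
      · simpa using hC

omit [NeZero Lc] in
/-- `0 ≤ Lc⁻² < 1` for `Lc ≥ 2`. -/
theorem theta_lt_one (hLc : 2 ≤ Lc) : 0 ≤ ((Lc : ℝ) ^ 2)⁻¹ ∧ ((Lc : ℝ) ^ 2)⁻¹ < 1 := by
  have hL : (2 : ℝ) ≤ Lc := by exact_mod_cast hLc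
  refine ⟨by positivity, ?_⟩
  rw [inv_lt_one_iff₀]
  right; nlinarith

/-- **mm CHANNEL OF `hKall`, CONDITIONAL** (`Lc ≥ 2`): under the dictionary identity the mm part of the unit-normalised step resolvents is
CAUCHY IN THE EXPONENTIALLY WEIGHTED NORM with rate `θ = Lc⁻²`: `DecayCauchy (j ↦ mmPart (D_jK_jD_j)) (|cΦ|·theta166Z·Lc⁻²/(1−Lc⁻²)) Lc⁻² (kappaZ/Lc)`
(`CombesThomas.decayCauchy_of_stepDecay` BY NAME). -/
theorem mm_decayCauchy_of_dict {cΦ : ℝ} (hLc : 2 ≤ Lc)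
    (hdict : ∀ (j : ℕ) (κ l : Fin (d + 1)) (z : Fin (d + 1) → ℤ),
      smStep d Lc j ^ 2 * wΦ (N := Lc ^ (j + 1)) κ l z = cΦ * deltaZ Lc (j + 1) (z, κ) (0, l)) :
    DecayCauchy (fun j => mmPart (KStepUnit (d := d) Lc j))
      (|cΦ| * theta166Z d * (((Lc : ℝ) ^ 2)⁻¹) / (1 - ((Lc : ℝ) ^ 2)⁻¹)) (((Lc : ℝ) ^ 2)⁻¹) (kappaZ d / Lc) := by
  have hθ := theta_lt_one (Lc := Lc) hLc
  refine decayCauchy_of_stepDecay (K := fun j => mmPart (KStepUnit (d := d) Lc j)) (fun j => mm_stepDecays_of_dict hdict j) ?_ hθ.1 hθ.2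
  have := T4Rate166StripDirect.C166_pos (d + 1); unfold theta166Z; positivity

/-- **THE mm CHANNEL OF THE WALL'S PROPAGATOR BINDERS, CONDITIONAL ON THE S6-mm DICTIONARY** (`Lc ≥ 2`): explicit `C, δ > 0, cK, 0 ≤ θ < 1`
with `UniformDecays` (shape of `hK`) AND `DecayCauchy` (shape of `hKall`) for the mm parts `j ↦ mmPart (D_j · KInvStep Lc j · D_j)` at the
adopted units — every constant Bałaban's ((1.66) layer: `c166Z`, `theta166Z`, `kappaZ` of p2's PART 8) times the dictionary constant `|cΦ|`. -/
theorem mm_binders_of_dict {cΦ : ℝ} (hLc : 2 ≤ Lc)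
    (hdict : ∀ (j : ℕ) (κ l : Fin (d + 1)) (z : Fin (d + 1) → ℤ),
      smStep d Lc j ^ 2 * wΦ (N := Lc ^ (j + 1)) κ l z = cΦ * deltaZ Lc (j + 1) (z, κ) (0, l)) :
    ∃ C δ cK θ : ℝ, 0 < δ ∧ 0 ≤ θ ∧ θ < 1 ∧
      UniformDecays (fun j => mmPart (KStepUnit (d := d) Lc j)) C δ ∧
      DecayCauchy (fun j => mmPart (KStepUnit (d := d) Lc j)) cK θ δ := by
  have hθ := theta_lt_one (Lc := Lc) hLc
  have hL : (0 : ℝ) < Lc := by exact_mod_cast lt_of_lt_of_le (by norm_num) hLc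
  exact ⟨_, _, _, _, div_pos (kappaZ_pos d) hL, hθ.1, hθ.2, mm_uniformDecays_of_dict hdict, mm_decayCauchy_of_dict hLc hdict⟩

end Conditional

/-! ## §4 What `wΦ` IS (unconditional, an2's side of the junction): the Green pairing of two minimiser columns — RECIPROCITY
(symmetry of the mm block) and positivity of the diagonal -/

section Reciprocity

variable {N : ℕ} [NeZero N]

open KKTFluctuationEnergy (lip1 lip2 lip2_comm lip1_curvAdj lip1_contourSumAdj summable_curv)
open ResolventComposition (Hcol HΦcol Hcol_apply HΦcol_apply curvAdj_curv_Hcol contourSum_Hcol Hcol_bdd_summable HΦcol_bdd)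
open AffineAveraging (curv)

/-- **THE GREEN PAIRING OF TWO MINIMISER COLUMNS IS A MULTIPLIER ENTRY**: `⟨curv ℋ_N(·;(l′,q)), curv ℋ_N(·;(κ,z))⟩ = wΦ κ l′ (z − q)` —
pair the gauge-free Euler–Lagrange identity `d*d ℋ_{(l′,q)} = 𝒬ᵀ Φ^ℋ_{(l′,q)}` of an5's `ResolventComposition` (gauge multiplier ZERO,
`wM_eq_zero`) against the column `ℋ_{(κ,z)}` and use its unit contour sums (`contourSum_Hcol`).  This is the value-level content of
«the mm block is the effective action of the constrained minimisation», and the mechanism of the S6 junction. -/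
theorem lip2_curv_Hcol_Hcol (l' κ : Fin (d + 1)) (q z : Fin (d + 1) → ℤ) :
    lip2 (curv (Hcol (N := N) l' q)) (curv (Hcol (N := N) κ z)) = wΦ (N := N) κ l' (z - q) := by
  obtain ⟨C, _, hbdd, hsum⟩ := Hcol_bdd_summable (N := N) (d := d)
  obtain ⟨CΦ, _, hΦ⟩ := HΦcol_bdd (N := N) (d := d)
  rw [lip2_comm, ← lip1_curvAdj (hbdd κ z) (fun a b => summable_curv (hsum l' q) a b), curvAdj_curv_Hcol,
    lip1_contourSumAdj (N := N) (hsum κ z) (hΦ l' q)]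
  have e : ∀ y, ∑ κ', HΦcol (N := N) l' q κ' y * AffineAveraging.contourSum N (Hcol (N := N) κ z) κ' y
      = if y = z then wΦ (N := N) κ l' (z - q) else 0 := by
    intro y
    simp only [contourSum_Hcol, HΦcol_apply, mul_ite, mul_one, mul_zero]
    by_cases hy : y = z
    · subst hy; simp
    · simp [hy]
  rw [tsum_congr e, tsum_ite_eq]

/-- **RECIPROCITY OF THE MULTIPLIER RESPONSE**: `wΦ κ l (z − q) = wΦ l κ (q − z)` — the mm block of an2's packed resolvent is SYMMETRIC
(the companion of an2's `Gam_symm` for the field–field block and of an5's `GamΦ_eq_neg_wH` for the mixed blocks). -/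
theorem wΦ_reciprocity (κ l : Fin (d + 1)) (z q : Fin (d + 1) → ℤ) :
    wΦ (N := N) κ l (z - q) = wΦ (N := N) l κ (q - z) := by
  rw [← lip2_curv_Hcol_Hcol, lip2_comm, lip2_curv_Hcol_Hcol]

/-- Reciprocity at the origin: `wΦ κ l z = wΦ l κ (−z)`. -/
theorem wΦ_symm (κ l : Fin (d + 1)) (z : Fin (d + 1) → ℤ) : wΦ (N := N) κ l z = wΦ (N := N) l κ (-z) := by
  have h := wΦ_reciprocity (N := N) κ l z 0
  rwa [sub_zero, zero_sub] at h

/-- The diagonal of the multiplier response is an ENERGY, hence nonnegative: `0 ≤ wΦ l l 0 = Σ |curv ℋ_l|²`. -/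
theorem wΦ_self_nonneg (l : Fin (d + 1)) : 0 ≤ wΦ (N := N) l l 0 := by
  rw [← sub_self (0 : Fin (d + 1) → ℤ), ← lip2_curv_Hcol_Hcol (N := N) l l 0 0]
  unfold KKTFluctuationEnergy.lip2
  exact tsum_nonneg fun x => Finset.sum_nonneg fun κ _ => Finset.sum_nonneg fun l₂ _ => mul_self_nonneg _

/-- **THE mm BLOCK OF THE PACKED RESOLVENT IS SYMMETRIC**: `KInv x y (inr κ) (inr l) = KInv y x (inr l) (inr κ)`. -/
theorem KInv_inr_inr_symm (κ l : Fin (d + 1)) (x y : Fin (d + 1) → ℤ) :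
    KInv (N := N) x y (Sum.inr κ) (Sum.inr l) = KInv (N := N) y x (Sum.inr l) (Sum.inr κ) := by
  simp only [KInv]
  by_cases hx : Torus.proj N x = 0
  · by_cases hy : Torus.proj N y = 0
    · rw [if_pos ⟨hx, hy⟩, if_pos ⟨hy, hx⟩, wΦ_reciprocity]
    · rw [if_neg (fun h => hy h.2), if_neg (fun h => hy h.1)]
  · rw [if_neg (fun h => hx h.1), if_neg (fun h => hx h.2)]

end Reciprocity

/-- **THE mm BLOCK OF THE STEP RESOLVENT IS SYMMETRIC** (every `j`, any units): `D_jK_jD_j (x′,y′)_{inr κ, inr l} = D_jK_jD_j (y′,x′)_{inr l, inr κ}`. -/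
theorem unitK_KInvStep_inr_inr_symm (sf sm : ℕ → ℝ) (j : ℕ) (κ l : Fin (d + 1)) (x' y' : Fin (d + 1) → ℤ) :
    unitK (sf j) (sm j) (KInvStep (d := d) Lc j) x' y' (Sum.inr κ) (Sum.inr l) =
      unitK (sf j) (sm j) (KInvStep (d := d) Lc j) y' x' (Sum.inr l) (Sum.inr κ) := by
  rw [unitK_KInvStep_inr_inr, unitK_KInvStep_inr_inr]
  by_cases hx : Torus.proj Lc x' = 0
  · by_cases hy : Torus.proj Lc y' = 0
    · rw [if_pos ⟨hx, hy⟩, if_pos ⟨hy, hx⟩, wΦ_reciprocity]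
    · rw [if_neg (fun h => hy h.2), if_neg (fun h => hy h.1)]
  · rw [if_neg (fun h => hx h.1), if_neg (fun h => hx h.2)]

end

end Summit.QuantumFields.BalabanUV.Beta.GAN24.TransverseDictionary
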